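import Literature.AlgebraicGeometry.AbelianSchemes.PoincarePullbackSliceTrivialOnComponent
import Literature.AlgebraicGeometry.Morphisms.LocallyNoetherianLocallyConnected
import Literature.AlgebraicGeometry.AbelianSchemes.LevelStructureTwist
import Mathlib.AlgebraicGeometry.ResidueField
import HarnessLib

/-!
# Spreading triviality of a torsion slice of `(π × 1)^*𝒫` from a non-empty open to a geometric point (HECKE-LINK (K4-spread))

Layer `Literature/AlgebraicGeometry/AbelianSchemes`, namespace `Literature.AlgebraicGeometry.AbelianSchemes.AbelianSchemeOver.DualPair`.
THEOREMS ONLY (no definition, no named fact, no instance).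

Setting of ★ `PoincarePullbackSliceTrivialOnComponent` ([MumfordAV1970] §15 Thm. 1, the two-step descent): `A/S` an abelian scheme
over a reduced locally Noetherian base with dual pair `D = (Â, 𝒫)` and unit hypothesis `hD`, `B := A/K`, `π : B → A` with
`ψ ≫ π = [n]_A`, `N := (π × 1_Â)^*𝒫` on `B ×_S Â`, `n` invertible in every residue field of `S`, and a level-`n` structure `φ̂`
on `Â`.  **`exists_point_slice_iso_unit_of_nonempty`** — the hypothesis `hspread` of ★ B-p02 (g11)'s
`PoincarePullbackCharOfCount.section_mem_of_spread_of_ncard_le` (p750413), verbatim: if the slice `(1_B × φ̂(c))^*N` is trivial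
over some NON-EMPTY `w : U → S`, then it is trivial at some `Ω₀`-valued point `t` of `S` — provided every connected component of `S`
has an `Ω₀`-point (raw binder `hpt`; for `S` of finite type over `ℂ = Ω₀` every component has a complex point).  Road: the
connected component `C ∋ w(u)` is clopen (★ `LocallyNoetherianLocallyConnected`); over the open subscheme `C` (connected,
reduced, locally Noetherian, `n` a unit in `Γ(C, 𝒪)`) the slice is trivial by ★ (K4)
`nonempty_pullback_baseChangeToProd_slice_iso_unit_of_nonempty` (p750404) applied to `U ∩ w⁻¹C ≠ ∅`; restrict to an `Ω₀`-point of
`C`.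

* §1 transport of «the slice `(1_B × a)^*N` over `f` is trivial» along equal data `(f, a) = (f′, a′)` and along a morphism of
  test schemes; the unit `n ∈ Γ(T, 𝒪)ˣ` from the residue fields;
* §2 the theorem.

Cell `hodgecm-mathlib` (D-0151), HECKE-LINK socket (B), brick (K)/(K5b) (B-plan1 (g14) 21:39:01Z (P1)/(P2); B-p09 (g10) 23:11:21Z
road (R-ℂ); B-p02 (g11) 23:26:21Z).  Count-neutral; HC_CM is proved only modulo the 7 printed citations until rung 0 closes.

## References
* [MumfordAV1970] D. Mumford, *Abelian Varieties* (1970), §15 Thm. 1 (p. 143).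
* [MumfordFogartyKirwan1994] D. Mumford, J. Fogarty, F. Kirwan, *GIT* (3rd ed. 1994), Ch. 7 §2 Definition 7.1 (p. 129).
* [StacksProject] Tag 04MF.
-/

set_option autoImplicit false

noncomputable section

-- `(B.X ⊗ T′).left = (B.baseChange T′.hom).left`, `B.X = A.quotientOver u K` hold by `rfl` only.
set_option backward.isDefEq.respectTransparency false

universe u

open CategoryTheory CategoryTheory.Limits AlgebraicGeometry MonoidalCategory CartesianMonoidalCategory TopologicalSpace
open scoped MonObj

namespace Literature.AlgebraicGeometry.AbelianSchemes.AbelianSchemeOver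

open Literature.AlgebraicGeometry.RelativeSpec Literature.AlgebraicGeometry.Modules Literature.AlgebraicGeometry.Motives
  Literature.AlgebraicGeometry.Morphisms

/-! ## §1 Plumbing: transport of slice-triviality; the unit `n` -/

section Plumbing

variable {S : Scheme.{u}} (X B : AbelianSchemeOver S) (N : (X.prodLeft B).Modules)

/-- Triviality of the slice `(1_X × a)^*N` over `f` only depends on the pair `(f, a)` (transport along equalities of the base
morphism and of the point). [cite: MumfordFogartyKirwan1994, Ch. 7 §2 Definition 7.1 (p. 129)] -/
theorem nonempty_slice_iso_unit_congr {T : Scheme.{u}} {f f' : T ⟶ S} (hf : f = f') {a a' : T ⟶ B.X.left} (ha : a = a')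
    (h : a ≫ B.X.hom = f) (h' : a' ≫ B.X.hom = f')
    (e : Nonempty ((Scheme.Modules.pullback (X.baseChangeToProd B f a h)).obj N ≅ SheafOfModules.unit _)) :
    Nonempty ((Scheme.Modules.pullback (X.baseChangeToProd B f' a' h')).obj N ≅ SheafOfModules.unit _) := by
  subst hf ha
  exact e

/-- Triviality of the slice is inherited along any morphism `v : T′ → T` of test schemes: `(1_X × (v ≫ a))^*N` is the
pull-back of `(1_X × a)^*N` along `X_v`. [cite: MumfordFogartyKirwan1994, Ch. 7 §2 Definition 7.1 (p. 129)] -/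
theorem nonempty_slice_iso_unit_comp {T T' : Scheme.{u}} (f : T ⟶ S) (v : T' ⟶ T) (a : T ⟶ B.X.left) (ha : a ≫ B.X.hom = f)
    (e : Nonempty ((Scheme.Modules.pullback (X.baseChangeToProd B f a ha)).obj N ≅ SheafOfModules.unit _)) :
    Nonempty ((Scheme.Modules.pullback (X.baseChangeToProd B (v ≫ f) (v ≫ a) (by rw [Category.assoc, ha]))).obj N ≅
      SheafOfModules.unit _) := by
  obtain ⟨e⟩ := e
  haveI : IsIso (C := (X.X ⊗ Over.mk (v ≫ f)).left.Modules)
      (SheafOfModules.pullbackObjUnitToUnit (X.X ◁ (Over.homMk v rfl : Over.mk (v ≫ f) ⟶ Over.mk f)).left.toRingCatSheafHom) := by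
    haveI := Literature.AlgebraicGeometry.KTheory.final_opensMap (X.X ◁ (Over.homMk v rfl : Over.mk (v ≫ f) ⟶ Over.mk f)).left
    exact SheafOfModules.instIsIsoPullbackObjUnitToUnitOfFinal _
  exact ⟨((Scheme.Modules.pullbackCongr (X.whiskerLeft_left_comp_baseChangeToProd B (Over.mk f) v a ha)).app N).symm ≪≫
    ((Scheme.Modules.pullbackComp _ _).app N).symm ≪≫
    (Scheme.Modules.pullback (X.X ◁ (Over.homMk v rfl : Over.mk (v ≫ f) ⟶ Over.mk f)).left).mapIso e ≪≫
    asIso (C := (X.X ⊗ Over.mk (v ≫ f)).left.Modules)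
      (SheafOfModules.pullbackObjUnitToUnit (X.X ◁ (Over.homMk v rfl : Over.mk (v ≫ f) ⟶ Over.mk f)).left.toRingCatSheafHom)⟩

omit N in
/-- **`n` is a unit in `Γ(T, 𝒪_T)` when it is non-zero in every residue field of `T`** (a section which is a unit in every
stalk is a unit). [cite: StacksProject, Tag 04MF] -/
theorem isUnit_natCast_of_forall_residueField (T : Scheme.{u}) (n : ℕ) (hn : ∀ t : T, (n : T.residueField t) ≠ 0) :
    IsUnit (n : Γ(T, ⊤)) := by
  refine T.toRingedSpace.isUnit_of_isUnit_germ ⊤ _ fun x hx => ?_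
  rw [map_natCast]
  by_contra hnu
  have hmem : (n : T.presheaf.stalk x) ∈ IsLocalRing.maximalIdeal (T.presheaf.stalk x) := hnu
  have h0 : IsLocalRing.residue (T.presheaf.stalk x) (n : T.presheaf.stalk x) = 0 :=
    (IsLocalRing.residue_eq_zero_iff _).mpr hmem
  rw [map_natCast] at h0
  exact hn x h0

/-- The underlying morphism of `toUnit T ≫ σ` is `T.hom ≫ σ.left`. [cite: MumfordFogartyKirwan1994, Ch. 7 §2 Definition 7.1 (p. 129)] -/
theorem toUnit_comp_left (T : Over S) (σ : B.Sections) : (toUnit T ≫ σ).left = T.hom ≫ σ.left := by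
  have h : (toUnit T).left = T.hom := by
    have hw := Over.w (toUnit T)
    rw [Over.tensorUnit_hom] at hw
    exact (Category.comp_id (toUnit T).left).symm.trans hw
  rw [Over.comp_left, h]

end Plumbing

/-! ## §2 The spreading theorem -/

variable {S : Scheme.{u}} (A : AbelianSchemeOver S)
  {Y : Scheme.{u}} (u : S ⟶ Y) (K : Subgroup A.Sections) [IsCommMonObj A.X] {n : ℕ}
  (hK : ∀ σ : K, (σ : A.Sections) ^ n = 1)
  [Finite K] [Y.IsSeparated] [IsSeparated (A.X.hom ≫ u)] [S.IsSeparated]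
  (hcov : ∀ x : A.left, ∃ O : (A.translationActionOver u K).StableAffineOpens, x ∈ O.1)
  [LocallyOfFiniteType (A.X.hom ≫ u)] [IsLocallyNoetherian Y]
  (hG : ∃ _ : GrpObj (A.quotientOver u K), IsMonHom (A.quotientMk u K hcov))
  (hsm : Smooth (A.quotientOver u K).hom) (hgc : GeometricallyConnected (A.quotientOver u K).hom)
  (D : A.DualPair) [IsAffine Y]
  (hfree : ∀ (Ω : Type u) [Field Ω] [IsAlgClosed Ω] (x : Spec (.of Ω) ⟶ A.left) (σ : K), σ ≠ 1 →
    x ≫ (A.translation (σ : A.Sections)).left ≠ x)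

namespace DualPair

include hK hfree in
/-- **`hspread`: a torsion slice of `N = (π × 1)^*𝒫` trivial over some non-empty `U → S` is trivial at some `Ω₀`-point of `S`.**
For `S` reduced and locally Noetherian with `n` non-zero in its residue fields, the unit hypothesis `hD`, a level-`n` structure
`φ̂` on `Â`, and `Ω₀` algebraically closed such that every connected component of `S` has an `Ω₀`-point (`hpt`): if
`(1_B × φ̂(c))^*N` is trivial over a non-empty `w : U → S`, then it is trivial at `φ̂(c)(t)` for some `t : Spec Ω₀ → S` —
componentwise ★ (K4) (`nonempty_pullback_baseChangeToProd_slice_iso_unit_of_nonempty`) on the clopen component through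
`w(u)` (★ `isClopen_connectedComponent_of_isLocallyNoetherian`), then restriction to an `Ω₀`-point of that component.  This is
the binder `hspread` of ★ `PoincarePullbackCharOfCount.section_mem_of_spread_of_ncard_le` at `X := A/K`, `π := mulNDesc`.
[cite: MumfordAV1970, §15 Thm. 1 (p. 143)] [cite: MumfordFogartyKirwan1994, Ch. 7 §2 Definition 7.1 (p. 129)] -/
theorem exists_point_slice_iso_unit_of_nonempty [IsReduced S] [IsLocallyNoetherian S] (Ω₀ : Type u) [Field Ω₀]
    [IsAlgClosed Ω₀] (hD : Nonempty ((Scheme.Modules.pullback (unitHatSlice D)).obj D.P ≅ SheafOfModules.unit _))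
    (hn : ∀ s : S, (n : S.residueField s) ≠ 0) {g : ℕ} (φ : LevelStructure g n D.hat)
    (hpt : ∀ s : S, ∃ t : Spec (.of Ω₀) ⟶ S, t.base (IsLocalRing.closedPoint Ω₀) ∈ connectedComponent s)
    (c : Fin g ⊕ Fin g → ZMod n) {U : Scheme.{u}} (w : U ⟶ S) [Nonempty U]
    (hU : Nonempty ((Scheme.Modules.pullback ((A.quotientBy u K hcov hG hsm hgc).baseChangeToProd D.hat w
        ((toUnit (Over.mk w) ≫ φ.section_ c : Over.mk w ⟶ D.hat.X)).left (Over.w _))).obj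
      ((Scheme.Modules.pullback (A.mulNDesc u K hK hcov ▷ D.hat.X).left).obj D.P) ≅ SheafOfModules.unit _)) :
    ∃ t : Spec (.of Ω₀) ⟶ S, Nonempty ((Scheme.Modules.pullback
      ((A.quotientBy u K hcov hG hsm hgc).baseChangeToProd D.hat t (D.hat.restrict t (φ.section_ c)).left (Over.w _))).obj
        ((Scheme.Modules.pullback (A.mulNDesc u K hK hcov ▷ D.hat.X).left).obj D.P) ≅ SheafOfModules.unit _) := by
  haveI : IsCommMonObj D.hat.X := D.hat.isCommMonObj_of_isReduced_base
  obtain ⟨u₀⟩ := ‹Nonempty U›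
  -- the connected component of `w(u₀)`, a clopen subscheme `C ↪ S`
  let s₀ : S := w.base u₀
  let C : S.Opens := ⟨connectedComponent s₀, isOpen_connectedComponent_of_isLocallyNoetherian S s₀⟩
  haveI : PreconnectedSpace (Over.mk C.ι).left :=
    Subtype.preconnectedSpace (isPreconnected_connectedComponent (x := s₀))
  haveI : IsReduced (Over.mk C.ι).left := isReduced_of_isOpenImmersion C.ι
  haveI : IsLocallyNoetherian (Over.mk C.ι).left := inferInstanceAs (IsLocallyNoetherian C)
  -- `n` is a unit on `C`
  have hnC : IsUnit (n : Γ((Over.mk C.ι).left, ⊤)) := by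
    refine isUnit_natCast_of_forall_residueField (C : Scheme.{u}) n fun x h0 => hn (C.ι.base x) ?_
    apply (C.ι.residueFieldMap x).hom.injective
    rw [map_natCast, map_zero]
    exact h0
  -- the `n`-torsion `C`-valued point `σ_c|_C`
  let c' : Over.mk C.ι ⟶ D.hat.X := toUnit (Over.mk C.ι) ≫ φ.section_ c
  have hc' : c' ^ n = 1 := by
    change (toUnit (Over.mk C.ι) ≫ φ.section_ c) ^ n = 1
    rw [← MonObj.comp_pow, show (φ.section_ c) ^ n = 1 from D.hat.sectionPow_pow_eq_one φ.pow_σ c, MonObj.comp_one]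
  -- the non-empty open `U_C := w⁻¹ C` of `U`, mapping to `C`
  haveI : Nonempty (↑(w ⁻¹ᵁ C) : Scheme.{u}) := ⟨⟨u₀, (mem_connectedComponent : s₀ ∈ connectedComponent s₀)⟩⟩
  -- triviality over `U_C`, as a slice over `(w ∣_ C) ≫ C.ι` at the point `(w ∣_ C) ≫ c′`
  have hUC : Nonempty ((Scheme.Modules.pullback ((A.quotientBy u K hcov hG hsm hgc).baseChangeToProd D.hat
      ((w ∣_ C) ≫ (Over.mk C.ι).hom) ((w ∣_ C) ≫ c'.left) (by rw [Category.assoc, Over.w c']))).obj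
      ((Scheme.Modules.pullback (A.mulNDesc u K hK hcov ▷ D.hat.X).left).obj D.P) ≅ SheafOfModules.unit _) := by
    refine nonempty_slice_iso_unit_congr (A.quotientBy u K hcov hG hsm hgc) D.hat _ (morphismRestrict_ι w C).symm ?_ _ _
      (nonempty_slice_iso_unit_comp (A.quotientBy u K hcov hG hsm hgc) D.hat _ w (w ⁻¹ᵁ C).ι _ (Over.w _) hU)
    rw [toUnit_comp_left, toUnit_comp_left]
    change (w ⁻¹ᵁ C).ι ≫ w ≫ (φ.section_ c).left = (w ∣_ C) ≫ C.ι ≫ (φ.section_ c).left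
    rw [← Category.assoc, ← Category.assoc, morphismRestrict_ι]
  -- ★ (K4) on the component
  have hC := nonempty_pullback_baseChangeToProd_slice_iso_unit_of_nonempty A u K hK hcov hG hsm hgc D hfree hD
    (Over.mk C.ι) hnC c' hc' (w ∣_ C) hUC
  -- an `Ω₀`-point of `C`
  obtain ⟨t, ht⟩ := hpt s₀
  have hrange : Set.range t.base ⊆ Set.range C.ι.base := by
    rintro _ ⟨p, rfl⟩
    rw [Scheme.Opens.range_ι]
    rw [Subsingleton.elim p (IsLocalRing.closedPoint Ω₀)]
    exact ht
  let t' : Spec (.of Ω₀) ⟶ (C : Scheme.{u}) := IsOpenImmersion.lift C.ι t hrange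
  have ht' : t' ≫ C.ι = t := IsOpenImmersion.lift_fac C.ι t hrange
  refine ⟨t, nonempty_slice_iso_unit_congr (A.quotientBy u K hcov hG hsm hgc) D.hat _ ht' ?_ _ _
    (nonempty_slice_iso_unit_comp (A.quotientBy u K hcov hG hsm hgc) D.hat _ (Over.mk C.ι).hom t' c'.left (Over.w c') hC)⟩
  rw [toUnit_comp_left]
  change t' ≫ C.ι ≫ (φ.section_ c).left = _
  rw [← Category.assoc, ht']
  rfl

end DualPair

end Literature.AlgebraicGeometry.AbelianSchemes.AbelianSchemeOver

end
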